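import Mathlib
import HarnessLib
import Summits.HubbardSuperconductivity.HubbardSuperconductivity.Theorems.KLProgrammeKLRegimeEngineTowerModelDefsRate
import Summits.HubbardSuperconductivity.HubbardSuperconductivity.Theorems.KLProgrammeKLRegimeEngineTowerModelDefsPow
import Summits.HubbardSuperconductivity.HubbardSuperconductivity.Theorems.KLProgrammeKLRegimeEngineTowerBlockIncrWt

/-!
# Route `KLProgramme` — crux K3 ENGINE (stmt-HubbardSuperconductivity-20437 `KLRegimeEngineV17F2`), stub (b) / E1 interface (E2) in-tower route and located risk #17
# «(C2)-MOMENTS»: MODEL TOWER DATA AT WEIGHT POWER `Dw` — the degree-`Dw` twins of the rate-decoupled size arrays of `…EngineTowerModelDefsRate`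
# (recipe «(E2)-POW3-TRACK» item T5 «carriers», HOME/hubbard-kl-k3c3-p2/g19/E2-POW3-TRACK-RECIPE.md; pen g27 (R465)(E); cell gate-hubbard-kl, seat hubbard-kl-k3c3-p2 g19)

`…EngineTowerModelDefsRate` (`klTowerBornWtAt`, `klTowerMeasWtAt`) are the degree-1 (`klScaleWt`) born / measured size arrays of the blocked tower; `…EngineTowerModelDefsPow`
(k3c2-p3 g10) is the degree-`Dw` CARRIER `klWtPinnedSumPow L M β μ K J j Dw m T q w` (weight `klScaleWtPow … j Dw = (1 + Λ_j·diam)^{Dw}`).  A power-`Dw` track of the tower (born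
two-leg sizes with power-3 / power-5 weights for the (E2) reader's symbol data and #17-Z's space moments; the doors `klWtPinnedSumPow_klTowerIncr_le` /
`klWtPinnedSumPow_klTowerIncr_subTadpole_le` are in …TowerBlockIncrWtPowAt / …PowAtSubTadpole) needs the corresponding ARRAYS, so that a law can be stated block by block:

* §1 **`klTowerBornWtPowAt L M β U μ K d k j Dw m`** — born degree-`Dw` size of `Δ_k` at `F_{dk}`, rate `j`: `⨆` over pins of `klWtPinnedSumPow … (dk) j Dw m Δ_k`;
  **`klTowerBornWtPowSubTadAt L M β U μ K d k j Dw m`** — the same for the increment WITHOUT ITS BLOCK TADPOLE `Δ_k − Δ_Γ 𝒱_{dk}` (`Γ = C^K_{(Λ_{d(k+1)},Λ_{dk}]}`; located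
  item «(E2)-ROUTE-TADPOLE»); **`klTowerMeasWtPowAt L M β U μ K d k j Dw m`** — measured degree-`Dw` size of the input `𝒱_{dk}` at `F_{dk−1}`, rate `j`;
* §2 the `le_ciSup` rows, nonnegativity, and **degree one is the degree-1 array** (`klTowerBornWtPowAt_one`, `klTowerMeasWtPowAt_one`, by `klWtPinnedSumPow_one`).
Definitions with bodies + order rows; nothing about the model is asserted; nothing asserts (E2), (X).3, any stub, K3 or superconductivity.
References: BGM 2006 §2.7 (2.70)–(2.71a), §2.8 (2.76)–(2.77), §3 (3.5)–(3.6) [cite: BenfattoGiulianiMastropietro2006].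
-/

noncomputable section

namespace Summit.HubbardSuperconductivity.HubbardSuperconductivity.Theorems.EngineV8

set_option linter.dupNamespace false -- summit = problem name (single-conjunct summit), D-0017

open Real Finset Literature.MathematicalPhysics.QuantumLattice Literature.Probability.LatticeModels
open Literature.Probability.LatticeModels.BattleFederbush
open Literature.MathematicalPhysics.QuantumLattice.GrassmannAlgebra
open Summit.HubbardSuperconductivity.HubbardSuperconductivity.Theorems.KLRegimeSplit
open Summit.HubbardSuperconductivity.HubbardSuperconductivity.Theorems.KLProgrammeLegKernels
open Summit.HubbardSuperconductivity.HubbardSuperconductivity.Theorems.DispersionFlow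

/-! ## §1 The degree-`Dw` rate-decoupled size arrays -/

section Arrays

variable (L M : ℕ) [NeZero L]

/-- **`klTowerBornWtPowAt L M β U μ K d k j Dw m`** — the BORN degree-`Dw` weighted size of block `k` in degree `m` at rate index `j`: the supremum over pins `(q, w)` of
`klWtPinnedSumPow L M β μ K (dk) j Dw m Δ_k q w`, `Δ_k = klTowerIncr … d k`, at the born family `F_{dk}`.
[cite: BenfattoGiulianiMastropietro2006, §2.8 (2.76)-(2.77), §3 (3.5)-(3.6)] -/
def klTowerBornWtPowAt (β U μ : ℝ) (K : TrigPolyC4v) (d k j Dw m : ℕ) : ℝ :=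
  ⨆ qw : Fin m × (SpaceTimeIdx L M × SectorLeg (sectorCount (d * k))),
    klWtPinnedSumPow L M β μ K (d * k) j Dw m (klTowerIncr L M β U μ K d k) qw.1 qw.2

/-- **`klTowerBornWtPowSubTadAt L M β U μ K d k j Dw m`** — the born degree-`Dw` weighted size of block `k`'s increment WITHOUT ITS BLOCK TADPOLE,
`Δ_k − Δ_Γ 𝒱_{dk}` with `Γ = C^K_{(Λ_{d(k+1)}, Λ_{dk}]}` (the one-line contraction of the input removed: for two legs the quartic tadpole, whose bare-`U` part is exactly
local), at `F_{dk}`, rate `j`. [cite: BenfattoGiulianiMastropietro2006, §2.7 (2.70)-(2.71a), (2.86)-(2.90)] -/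
def klTowerBornWtPowSubTadAt (β U μ : ℝ) (K : TrigPolyC4v) (d k j Dw m : ℕ) : ℝ :=
  ⨆ qw : Fin m × (SpaceTimeIdx L M × SectorLeg (sectorCount (d * k))),
    klWtPinnedSumPow L M β μ K (d * k) j Dw m
      (klTowerIncr L M β U μ K d k -
        grassmannLaplacian ℂ (hubbardCovSliceCT L M β μ 0 K (klScale klE0 (d * (k + 1))) (klScale klE0 (d * k))) (klTowerInput L M β U μ K d k))
      qw.1 qw.2

/-- **`klTowerMeasWtPowAt L M β U μ K d k j Dw m`** — the MEASURED degree-`Dw` weighted size of the input `𝒱_{dk}` of block `k` at `F_{dk−1}`, rate `j`.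
[cite: BenfattoGiulianiMastropietro2006, §2.8 (2.76)-(2.77), §3 (3.5)-(3.6)] -/
def klTowerMeasWtPowAt (β U μ : ℝ) (K : TrigPolyC4v) (d k j Dw m : ℕ) : ℝ :=
  ⨆ qw : Fin m × (SpaceTimeIdx L M × SectorLeg (sectorCount (d * k - 1))),
    klWtPinnedSumPow L M β μ K (d * k - 1) j Dw m (klTowerInput L M β U μ K d k) qw.1 qw.2

end Arrays

/-! ## §2 Order rows -/

section Rows

variable {L M : ℕ} [NeZero L]

/-- Every pinned degree-`Dw` sum of `Δ_k` at `F_{dk}` is at most the born array entry. [cite: BenfattoGiulianiMastropietro2006, §2.8 (2.76)-(2.77)] -/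
theorem klWtPinnedSumPow_le_klTowerBornWtPowAt (β U μ : ℝ) (K : TrigPolyC4v) (d k j Dw m : ℕ) (q : Fin m)
    (w : SpaceTimeIdx L M × SectorLeg (sectorCount (d * k))) :
    klWtPinnedSumPow L M β μ K (d * k) j Dw m (klTowerIncr L M β U μ K d k) q w ≤ klTowerBornWtPowAt L M β U μ K d k j Dw m :=
  le_ciSup (f := fun qw : Fin m × (SpaceTimeIdx L M × SectorLeg (sectorCount (d * k))) =>
    klWtPinnedSumPow L M β μ K (d * k) j Dw m (klTowerIncr L M β U μ K d k) qw.1 qw.2) (Set.finite_range _).bddAbove (q, w)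

/-- Every pinned degree-`Dw` sum of the tadpole-free increment at `F_{dk}` is at most its born array entry. [cite: BenfattoGiulianiMastropietro2006, §2.7 (2.70)-(2.71a)] -/
theorem klWtPinnedSumPow_le_klTowerBornWtPowSubTadAt (β U μ : ℝ) (K : TrigPolyC4v) (d k j Dw m : ℕ) (q : Fin m)
    (w : SpaceTimeIdx L M × SectorLeg (sectorCount (d * k))) :
    klWtPinnedSumPow L M β μ K (d * k) j Dw m
        (klTowerIncr L M β U μ K d k -
          grassmannLaplacian ℂ (hubbardCovSliceCT L M β μ 0 K (klScale klE0 (d * (k + 1))) (klScale klE0 (d * k))) (klTowerInput L M β U μ K d k)) q w ≤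
      klTowerBornWtPowSubTadAt L M β U μ K d k j Dw m :=
  le_ciSup (f := fun qw : Fin m × (SpaceTimeIdx L M × SectorLeg (sectorCount (d * k))) =>
    klWtPinnedSumPow L M β μ K (d * k) j Dw m
      (klTowerIncr L M β U μ K d k -
        grassmannLaplacian ℂ (hubbardCovSliceCT L M β μ 0 K (klScale klE0 (d * (k + 1))) (klScale klE0 (d * k))) (klTowerInput L M β U μ K d k))
      qw.1 qw.2) (Set.finite_range _).bddAbove (q, w)

/-- Every pinned degree-`Dw` sum of the input `𝒱_{dk}` at `F_{dk−1}` is at most the measured array entry. [cite: BenfattoGiulianiMastropietro2006, §2.8 (2.76)-(2.77)] -/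
theorem klWtPinnedSumPow_le_klTowerMeasWtPowAt (β U μ : ℝ) (K : TrigPolyC4v) (d k j Dw m : ℕ) (q : Fin m)
    (w : SpaceTimeIdx L M × SectorLeg (sectorCount (d * k - 1))) :
    klWtPinnedSumPow L M β μ K (d * k - 1) j Dw m (klTowerInput L M β U μ K d k) q w ≤ klTowerMeasWtPowAt L M β U μ K d k j Dw m :=
  le_ciSup (f := fun qw : Fin m × (SpaceTimeIdx L M × SectorLeg (sectorCount (d * k - 1))) =>
    klWtPinnedSumPow L M β μ K (d * k - 1) j Dw m (klTowerInput L M β U μ K d k) qw.1 qw.2) (Set.finite_range _).bddAbove (q, w)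

/-- Nonnegativity of the born degree-`Dw` array (`0 ≤ β`). [cite: BenfattoGiulianiMastropietro2006, §3 (3.5)-(3.6)] -/
theorem klTowerBornWtPowAt_nonneg {β : ℝ} (hβ : 0 ≤ β) (U μ : ℝ) (K : TrigPolyC4v) (d k j Dw m : ℕ) :
    0 ≤ klTowerBornWtPowAt L M β U μ K d k j Dw m := by
  unfold klTowerBornWtPowAt
  rcases isEmpty_or_nonempty (Fin m × (SpaceTimeIdx L M × SectorLeg (sectorCount (d * k)))) with h | h
  · rw [Real.iSup_of_isEmpty]
  · exact le_ciSup_of_le (Set.finite_range _).bddAbove (Classical.arbitrary _) (klWtPinnedSumPow_nonneg hβ μ K _ j Dw m _ _ _)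

/-- Nonnegativity of the tadpole-free born degree-`Dw` array (`0 ≤ β`). [cite: BenfattoGiulianiMastropietro2006, §3 (3.5)-(3.6)] -/
theorem klTowerBornWtPowSubTadAt_nonneg {β : ℝ} (hβ : 0 ≤ β) (U μ : ℝ) (K : TrigPolyC4v) (d k j Dw m : ℕ) :
    0 ≤ klTowerBornWtPowSubTadAt L M β U μ K d k j Dw m := by
  unfold klTowerBornWtPowSubTadAt
  rcases isEmpty_or_nonempty (Fin m × (SpaceTimeIdx L M × SectorLeg (sectorCount (d * k)))) with h | h
  · rw [Real.iSup_of_isEmpty]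
  · exact le_ciSup_of_le (Set.finite_range _).bddAbove (Classical.arbitrary _) (klWtPinnedSumPow_nonneg hβ μ K _ j Dw m _ _ _)

/-- Nonnegativity of the measured degree-`Dw` array (`0 ≤ β`). [cite: BenfattoGiulianiMastropietro2006, §3 (3.5)-(3.6)] -/
theorem klTowerMeasWtPowAt_nonneg {β : ℝ} (hβ : 0 ≤ β) (U μ : ℝ) (K : TrigPolyC4v) (d k j Dw m : ℕ) :
    0 ≤ klTowerMeasWtPowAt L M β U μ K d k j Dw m := by
  unfold klTowerMeasWtPowAt
  rcases isEmpty_or_nonempty (Fin m × (SpaceTimeIdx L M × SectorLeg (sectorCount (d * k - 1)))) with h | h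
  · rw [Real.iSup_of_isEmpty]
  · exact le_ciSup_of_le (Set.finite_range _).bddAbove (Classical.arbitrary _) (klWtPinnedSumPow_nonneg hβ μ K _ j Dw m _ _ _)

/-- **Degree one is the degree-1 born array** `klTowerBornWtAt` (…TowerModelDefsRate). [cite: BenfattoGiulianiMastropietro2006, §3 (3.5)-(3.6)] -/
theorem klTowerBornWtPowAt_one (β U μ : ℝ) (K : TrigPolyC4v) (d k j m : ℕ) :
    klTowerBornWtPowAt L M β U μ K d k j 1 m = klTowerBornWtAt L M β U μ K d k j m := by
  unfold klTowerBornWtPowAt klTowerBornWtAt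
  simp only [klWtPinnedSumPow_one]

/-- **Degree one is the degree-1 measured array** `klTowerMeasWtAt`. [cite: BenfattoGiulianiMastropietro2006, §3 (3.5)-(3.6)] -/
theorem klTowerMeasWtPowAt_one (β U μ : ℝ) (K : TrigPolyC4v) (d k j m : ℕ) :
    klTowerMeasWtPowAt L M β U μ K d k j 1 m = klTowerMeasWtAt L M β U μ K d k j m := by
  unfold klTowerMeasWtPowAt klTowerMeasWtAt
  simp only [klWtPinnedSumPow_one]

/-- A born array at a HIGHER weight power dominates the lower one (`Dw ≤ Dw′`, weights `≥ 1`). [cite: BenfattoGiulianiMastropietro2006, §3 (3.5)-(3.6)] -/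
theorem klTowerBornWtPowAt_mono_degree {β : ℝ} (hβ : 0 ≤ β) (U μ : ℝ) (K : TrigPolyC4v) (d k j : ℕ) {Dw Dw' : ℕ} (hD : Dw ≤ Dw') (m : ℕ) :
    klTowerBornWtPowAt L M β U μ K d k j Dw m ≤ klTowerBornWtPowAt L M β U μ K d k j Dw' m := by
  unfold klTowerBornWtPowAt
  rcases isEmpty_or_nonempty (Fin m × (SpaceTimeIdx L M × SectorLeg (sectorCount (d * k)))) with h | h
  · rw [Real.iSup_of_isEmpty, Real.iSup_of_isEmpty]
  · exact ciSup_le fun qw => (klWtPinnedSumPow_mono_degree hβ μ K _ j hD m _ qw.1 qw.2).trans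
      (le_ciSup (f := fun qw : Fin m × (SpaceTimeIdx L M × SectorLeg (sectorCount (d * k))) =>
        klWtPinnedSumPow L M β μ K (d * k) j Dw' m (klTowerIncr L M β U μ K d k) qw.1 qw.2) (Set.finite_range _).bddAbove qw)

end Rows

end Summit.HubbardSuperconductivity.HubbardSuperconductivity.Theorems.EngineV8

end
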